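/-
Copyright (c) 2026 the pub-hodgecm-mathlib formalisation cell (harness21).  Prover seat hodgecm-mathlib-K2Liu-p12 (g0): Track B «K2-LIT»,
#184♮ = hLiu418 = stmt-HodgeConjecture-24832; Road Φ of socket #41, organ Φ5 «bad finite places» — the auxiliary DATA of the tie exist.
-/
import Summits.HodgeConjecture.HodgeConjecture.Theorems.K2LiuLocalRingValuationBalls   -- ★ F3c-1: the ball letter
import HarnessLib

/-!
# Crux `HLiu418`, Road Φ of socket #41, organ Φ5 — SUPPLY OF THE AUXILIARY DATA (`ε`, `c_ε`, `c₂`, `b_T`) of the bad-place Whittaker tie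

Cell `hodgecm-mathlib`, crux item hLiu418 = `stmt-HodgeConjecture-24832`, route of record `HCCMUnconditional`; squad K2 ∕ K2Liu, road `K2_Liu`,
socket #41, Road Φ, organ Φ5.  THEOREMS ONLY (no `def`, no `instance`, no `notation`, no named-fact hypothesis, no `sorry`); lane
`--supports stmt-HodgeConjecture-24832` (count-neutral helper; closes no socket by itself).

★ `K2LiuBadPlaceWhittakerEntire.whittaker_setIntegral_ball_eq` (the Φ5 tie) takes, besides the section∕character data, four pieces of AUXILIARY DATA in
the ball letter of ★ F3c-1 (`∀ w, Valued.v (r w) ≤ Valued.v (toPlace v w π) ^ a`): an integral `σ`-anti-invariant `ε ∈ E ⊗ F_v` with `ϖ^{c_ε} ∣ 2ε`, an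
exponent `c₂` with `ϖ^{c₂} ∣ 2`, and an exponent `b_T` bounding `T^{±1}` (and, for each Fourier index, `b, b′` bounding `β`, `β⁻¹`).  This file proves they
EXIST, unconditionally, so the consumer only chooses them:
* §1 `ℤₘ₀` one-liner `exists_zpow_le` (`γ ≠ 0`, `γ ≤ exp(−1)`, `x ≠ 0` ⇒ `∃ c, γ^c ≤ x`), and on `R = E ⊗ F_v`: **`exists_threshold_zpow_le`** (`r_w ≠ 0 ∀ w` ⇒
  `∃ c, ∀ w, v_w(ϖ_w)^c ≤ v_w(r_w)`), **`exists_mem_ball_elem`** (`∀ r, ∃ a, r ∈ ball a`), **`exists_mball`** (every matrix lies in some ball; so `b, b′, b_T` exist);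
* §2 **`exists_skewUnit`**: `∃ ε, σε = −ε ∧ ε integral ∧ ∃ c_ε, ϖ^{c_ε} ∣ 2ε` (`ε := ι_v(π)^k · δ̂`, `δ̂ = δ ⊗ 1`, `σδ = −δ`, `2δ ≠ 0` in each `E_w` of characteristic `0`);
  **`exists_two_threshold`**: `∃ c₂, ϖ^{c₂} ∣ 2`.

## References
* [CasselsFrohlichANT1967] J. W. S. Cassels, A. Fröhlich (eds.), *Algebraic Number Theory* (1967), Ch. II §10 (discrete valuations, `x = u ϖ^{m}`).
* [Casselman1980] W. Casselman, Compositio Math. 40 (1980), §3.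
-/

set_option autoImplicit false
-- the mandated namespace repeats the single-problem summit's segment (`HodgeConjecture.HodgeConjecture`)
set_option linter.dupNamespace false

noncomputable section

open scoped Matrix
open NumberField IsDedekindDomain Matrix
open Literature.NumberTheory.Automorphic Literature.NumberTheory.Automorphic.UnitaryGroup
open Summit.HodgeConjecture.HodgeConjecture.Cruxes.HLiu418.K2LiuLocalRingValuationBalls

namespace Summit.HodgeConjecture.HodgeConjecture.Cruxes.HLiu418.K2LiuBadPlaceWhittakerData

variable (F : Type) [Field F] [NumberField F] (E : Type) [Field E] [NumberField E] [Algebra F E] (c : E ≃ₐ[F] E)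
  (v : HeightOneSpectrum (𝓞 F)) {π : v.adicCompletion F} (hπ : Valued.v π = WithZero.exp (-1 : ℤ))

/-! ## §1 Every element ∕ matrix lies in some ball; non-zero elements are bounded below -/

/-- `ℤₘ₀`: for a threshold `0 ≠ γ ≤ exp(−1)` and `x ≠ 0` there is `c` with `γ^c ≤ x` (`c = |log x|`). [cite: CasselsFrohlichANT1967, Ch. II §10] -/
theorem exists_zpow_le {γ : WithZero (Multiplicative ℤ)} (h0 : γ ≠ 0) (h1 : γ ≤ WithZero.exp (-1 : ℤ)) {x : WithZero (Multiplicative ℤ)} (hx : x ≠ 0) :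
    ∃ c : ℤ, 0 ≤ c ∧ γ ^ c ≤ x := by
  have hγ : WithZero.log γ ≤ -1 := by rwa [← WithZero.exp_le_exp, WithZero.exp_log h0]
  refine ⟨|WithZero.log x|, abs_nonneg _, ?_⟩
  rw [← WithZero.exp_log hx, ← WithZero.exp_log h0, ← WithZero.exp_zsmul, WithZero.exp_le_exp, smul_eq_mul, WithZero.log_exp]
  nlinarith [abs_nonneg (WithZero.log x), neg_abs_le (WithZero.log x)]

include hπ in
/-- **non-zero elements of `E ⊗ F_v` are bounded below**: `∃ c, ∀ w, v_w(ϖ_w)^c ≤ v_w(r_w)` when every `r_w ≠ 0`. [cite: CasselsFrohlichANT1967, Ch. II §10] -/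
theorem exists_threshold_zpow_le {r : LocalRing E v} (hr : ∀ w : PlacesOver E v, r w ≠ 0) :
    ∃ cc : ℤ, ∀ w : PlacesOver E v, Valued.v (toPlace v w π) ^ cc ≤ Valued.v (r w) := by
  classical
  have hw : ∀ w : PlacesOver E v, ∃ cw : ℤ, 0 ≤ cw ∧ Valued.v (toPlace v w π) ^ cw ≤ Valued.v (r w) := fun w =>
    exists_zpow_le (valued_toPlace_uniformizer_ne_zero F E v hπ w) (valued_toPlace_uniformizer_le F E v hπ w) ((Valuation.ne_zero_iff _).2 (hr w))
  choose cw hcw0 hcw using hw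
  refine ⟨∑ w, cw w, fun w => le_trans ?_ (hcw w)⟩
  exact zpow_le_zpow_right_of_le_one₀ (zero_lt_iff.2 (valued_toPlace_uniformizer_ne_zero F E v hπ w)) (valued_toPlace_uniformizer_le_one F E v hπ w)
    (Finset.single_le_sum (f := cw) (fun w _ => hcw0 w) (Finset.mem_univ w))

include hπ in
/-- **every element of `E ⊗ F_v` lies in some ball**. [cite: CasselsFrohlichANT1967, Ch. II §10] -/
theorem exists_mem_ball_elem (r : LocalRing E v) : ∃ a : ℤ, ∀ w : PlacesOver E v, Valued.v (r w) ≤ Valued.v (toPlace v w π) ^ a := by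
  classical
  have hw : ∀ w : PlacesOver E v, ∃ aw : ℤ, Valued.v (r w) ≤ Valued.v (toPlace v w π) ^ aw := by
    intro w
    by_cases h : r w = 0
    · exact ⟨0, by rw [h, map_zero]; exact zero_le⟩
    · have hγ : WithZero.log (Valued.v (toPlace v w π)) ≤ -1 := by
        rw [← WithZero.exp_le_exp, WithZero.exp_log (valued_toPlace_uniformizer_ne_zero F E v hπ w)]
        exact valued_toPlace_uniformizer_le F E v hπ w
      have hx : Valued.v (r w) ≠ 0 := (Valuation.ne_zero_iff _).2 h
      refine ⟨-|WithZero.log (Valued.v (r w))|, ?_⟩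
      rw [← WithZero.exp_log hx, ← WithZero.exp_log (valued_toPlace_uniformizer_ne_zero F E v hπ w), ← WithZero.exp_zsmul, WithZero.exp_le_exp,
        smul_eq_mul, WithZero.log_exp]
      nlinarith [abs_nonneg (WithZero.log (Valued.v (r w))), le_abs_self (WithZero.log (Valued.v (r w)))]
  choose aw haw using hw
  refine ⟨-∑ w, |aw w|, fun w => (haw w).trans ?_⟩
  refine zpow_le_zpow_right_of_le_one₀ (zero_lt_iff.2 (valued_toPlace_uniformizer_ne_zero F E v hπ w)) (valued_toPlace_uniformizer_le_one F E v hπ w) ?_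
  have h1 : |aw w| ≤ ∑ w, |aw w| := Finset.single_le_sum (f := fun w => |aw w|) (fun w _ => abs_nonneg _) (Finset.mem_univ w)
  have h2 := neg_abs_le (aw w)
  omega

include hπ in
/-- **every matrix over `E ⊗ F_v` lies in some ball** (so the exponents `b`, `b′`, `b_T` of the Φ5 tie exist for `β`, `β⁻¹`, `T^{±1}`).
[cite: CasselsFrohlichANT1967, Ch. II §10] -/
theorem exists_mball {m : Type*} [Fintype m] (X : Matrix m m (LocalRing E v)) :
    ∃ a : ℤ, ∀ i j (w : PlacesOver E v), Valued.v (X i j w) ≤ Valued.v (toPlace v w π) ^ a := by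
  classical
  choose a ha using fun i j => exists_mem_ball_elem F E v hπ (X i j)
  refine ⟨-∑ i, ∑ j, |a i j|, fun i j w => (ha i j w).trans ?_⟩
  refine zpow_le_zpow_right_of_le_one₀ (zero_lt_iff.2 (valued_toPlace_uniformizer_ne_zero F E v hπ w)) (valued_toPlace_uniformizer_le_one F E v hπ w) ?_
  have h1 : |a i j| ≤ ∑ j, |a i j| := Finset.single_le_sum (f := fun j => |a i j|) (fun j _ => abs_nonneg _) (Finset.mem_univ j)
  have h2 : ∑ j, |a i j| ≤ ∑ i, ∑ j, |a i j| :=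
    Finset.single_le_sum (f := fun i => ∑ j, |a i j|) (fun i _ => Finset.sum_nonneg fun j _ => abs_nonneg _) (Finset.mem_univ i)
  have h3 := neg_abs_le (a i j)
  omega

include hπ in
/-- the same with a prescribed sign: every matrix lies in a ball `−b` with `0 ≤ b` (the shape of the tie's `b`, `b′`, `b_T`). [cite: CasselsFrohlichANT1967, Ch. II §10] -/
theorem exists_mball_neg {m : Type*} [Fintype m] (X : Matrix m m (LocalRing E v)) :
    ∃ b : ℤ, 0 ≤ b ∧ ∀ i j (w : PlacesOver E v), Valued.v (X i j w) ≤ Valued.v (toPlace v w π) ^ (-b) := by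
  obtain ⟨a, ha⟩ := exists_mball F E v hπ X
  refine ⟨|a|, abs_nonneg a, mball_antitone F E v hπ (by have := neg_abs_le a; omega) ha⟩

/-! ## §2 The anti-invariant integral element `ε` and the constants `c_ε`, `c₂` -/

include hπ in
/-- **`∃ c₂, ϖ^{c₂} ∣ 2`** (`2 ≠ 0` in every `E_w`, characteristic `0`). [cite: CasselsFrohlichANT1967, Ch. II §10] -/
theorem exists_two_threshold : ∃ c₂ : ℤ, ∀ w : PlacesOver E v, Valued.v (toPlace v w π) ^ c₂ ≤ Valued.v ((2 : LocalRing E v) w) :=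
  exists_threshold_zpow_le F E v hπ fun w => by rw [Pi.ofNat_apply]; exact two_ne_zero

include hπ in
/-- **THE ANTI-INVARIANT INTEGRAL ELEMENT**: for `σ δ = −δ`, `δ ≠ 0`, there is `ε ∈ E ⊗ F_v` with `σ ε = −ε`, `ε` integral, and `ϖ^{c_ε} ∣ 2ε` for some `c_ε`
(`ε := ι_v(π)^k · (δ ⊗ 1)` with `k` large). [cite: CasselsFrohlichANT1967, Ch. II §10] -/
theorem exists_skewUnit {δ : E} (hcδ : c δ = -δ) (hδ : δ ≠ 0) :
    ∃ ε : LocalRing E v, conjLocal E c v ε = -ε ∧ (∀ w : PlacesOver E v, Valued.v (ε w) ≤ 1) ∧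
      ∃ cε : ℤ, ∀ w : PlacesOver E v, Valued.v (toPlace v w π) ^ cε ≤ Valued.v ((2 * ε) w) := by
  -- the element `δ̂ = δ ⊗ 1`, its ball, and the rescaling exponent
  obtain ⟨a, ha⟩ := exists_mem_ball_elem F E v hπ (algebraMap E (LocalRing E v) δ)
  have hδw : ∀ w : PlacesOver E v, algebraMap E (LocalRing E v) δ w ≠ 0 := fun w => by
    rw [Pi.algebraMap_apply]
    exact (map_ne_zero_iff _ (algebraMap E (w.1.adicCompletion E)).injective).2 hδ
  set k : ℕ := (|a|).toNat with hk
  refine ⟨toLocalRing E v π ^ k * algebraMap E (LocalRing E v) δ, ?_, ?_, ?_⟩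
  · rw [map_mul, map_pow, conjLocal_toLocalRing, conjLocal_algebraMap, hcδ, map_neg, mul_neg]
  · intro w
    rw [Pi.mul_apply, Pi.pow_apply, map_mul, map_pow, toLocalRing_apply]
    have hne := valued_toPlace_uniformizer_ne_zero F E v hπ w
    calc Valued.v (toPlace v w π) ^ k * Valued.v (algebraMap E (LocalRing E v) δ w)
        ≤ Valued.v (toPlace v w π) ^ k * Valued.v (toPlace v w π) ^ a := mul_le_mul' le_rfl (ha w)
      _ = Valued.v (toPlace v w π) ^ ((k : ℤ) + a) := by rw [zpow_add₀ hne, zpow_natCast]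
      _ ≤ Valued.v (toPlace v w π) ^ (0 : ℤ) :=
          zpow_le_zpow_right_of_le_one₀ (zero_lt_iff.2 hne) (valued_toPlace_uniformizer_le_one F E v hπ w)
            (by have := Int.self_le_toNat |a|; have := neg_abs_le a; have := le_abs_self a; omega)
      _ = 1 := zpow_zero _
  · refine exists_threshold_zpow_le F E v hπ fun w => ?_
    rw [Pi.mul_apply, Pi.mul_apply, Pi.pow_apply, Pi.ofNat_apply, toLocalRing_apply]
    exact mul_ne_zero two_ne_zero (mul_ne_zero (pow_ne_zero _ ((map_ne_zero_iff _ (toPlace v w).injective).2 (uniformizer_ne_zero F v hπ))) (hδw w))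

end Summit.HodgeConjecture.HodgeConjecture.Cruxes.HLiu418.K2LiuBadPlaceWhittakerData

end
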